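import Summits.QuantumFields.GaugeBoot.DiagonalRPTorusHexCertOdd
import Summits.QuantumFields.GaugeBoot.DiagonalRPTorusHexShape
import HarnessLib

/-!
# Small joining clusters of the bent-hexagon pair on ODD tori are the short annulus (gauge-boot, L3 `d = 3` uniform window, odd leg, brick 4)

HONEST FRAMING (cell `pub-gaugeboot`, page 1 of every file): the venture produces certified bounds
on lattice expectations at stated coupling, gauge group, dimension and torus size; NOT a mass gap,
NOT a continuum limit, NOT a string tension; NOT Yang–Mills-summit-bearing (barriers
`FixedCouplingUltralocality`, `PerturbativeInvisibility`). This module is bookkeeping for a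
structural NEGATIVE result (a coupling window UNIFORM in the torus size for the failure of
closed-half diagonal reflection positivity on `(ℤ/L)^3`, `L` odd); it proves no window.

## Content (torus `(ℤ/L)^3`, `L = 2c + 1`, `c ≥ 15`, base `y` on the layer `δ(y) = c`)

* `hexTubeOdd y = Pt y tubeTodd` — the six-face annulus; ★★ **`eq_hexTubeOdd_or_hasForestSplit`** —
  every `Q ⊆ restPlaqs 0 1 (c+1)` with `#Q ≤ 6` is the annulus or has a forest split for
  `(Et y LE₁odd, Et y LE₂)` (bricks 2 + 3 of the odd leg with the odd rest test of brick 1);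
* `hexTubeOdd_subset_restPlaqs`, `card_hexTubeOdd`, `tjoins_hexTubeOdd`;
* ★★ **`sum_replicaTerm_small_eq_hexTubeOdd`** — the small joining clusters (`#Q ≤ 6`) contribute to
  the replica expansion only through the annulus (doubled forest principle).

Elementary given the bricks; no named fact.
-/

open MeasureTheory Finset Function

namespace Summit.QuantumFields.GaugeBoot

open Literature.MathematicalPhysics.QuantumFieldTheory

noncomputable section

namespace DiagRPHex

open DiagRPTube DiagRPUnif

variable {L : ℕ}

/-- The six-face annulus on an odd torus: the chart image of `tubeTodd`. -/
def hexTubeOdd (y : Site 3 L) : Finset (Plaquette 3 L) := Pt y tubeTodd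

variable (y : Site 3 L)

/-- ★ The chart data `LE₁odd` is the mirror image `θγ_{y₀}` of the hexagon at `y₀ = θ(y + e₀)`. -/
theorem Et_LE₁odd :
    Et y LE₁odd = (hexLinks (siteDiagSwap (0 : Fin 3) 1 (y.shift 0))).image (edgeDiagSwap (0 : Fin 3) 1) := by
  set w := y.shift 0 with hw
  have hsw : siteDiagSwap (0 : Fin 3) 1 (siteDiagSwap (0 : Fin 3) 1 w) = w := siteDiagSwap_siteDiagSwap _ _ _
  have himg : (hexLinks (siteDiagSwap (0 : Fin 3) 1 w)).image (edgeDiagSwap (0 : Fin 3) 1) =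
      {(w, 2), (w.shift 2, 0), ((w.shift 0).shift 2, 1), ((w.shift 1).shift 0, 2), (w.shift 0, 1), (w, 0)} := by
    simp only [hexLinks, image_insert, image_singleton, edgeDiagSwap, siteDiagSwap_shift, hsw]
    simp [Equiv.swap_apply_left, Equiv.swap_apply_right, Equiv.swap_apply_of_ne_of_ne]
  rw [himg]
  ext e
  simp only [Et, LE₁odd, List.map_cons, List.map_nil, List.toFinset_cons, List.toFinset_nil,
    insert_empty_eq, mem_insert, mem_singleton, edge]
  have h0 : site y (0, 0, 0) = y := by
    funext k; fin_cases k <;> simp [site]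
  have hw' : site y (1, 0, 0) = w := by
    rw [show ((1 : ℤ), (0 : ℤ), (0 : ℤ)) = (0, 0, 0) + lvec 0 by simp [lvec], site_add_lvec, h0]
  have h101 : site y (1, 0, 1) = w.shift 2 := by
    rw [show ((1 : ℤ), (0 : ℤ), (1 : ℤ)) = (1, 0, 0) + lvec 2 by simp [lvec], site_add_lvec, hw']
  have h201 : site y (2, 0, 1) = (w.shift 0).shift 2 := by
    rw [show ((2 : ℤ), (0 : ℤ), (1 : ℤ)) = (1, 0, 0) + lvec 0 + lvec 2 by simp [lvec], site_add_lvec,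
      site_add_lvec, hw']
  have h210 : site y (2, 1, 0) = (w.shift 1).shift 0 := by
    rw [show ((2 : ℤ), (1 : ℤ), (0 : ℤ)) = (1, 0, 0) + lvec 1 + lvec 0 by simp [lvec], site_add_lvec,
      site_add_lvec, hw']
  have h200 : site y (2, 0, 0) = w.shift 0 := by
    rw [show ((2 : ℤ), (0 : ℤ), (0 : ℤ)) = (1, 0, 0) + lvec 0 by simp [lvec], site_add_lvec, hw']
  simp only [hw', h101, h201, h210, h200]

/-! ## (J1) on the odd torus -/

variable {y} [NeZero L] {c : ℕ}

/-- ★★ **(J1, odd tori): every set of at most six rest plaquettes is the short annulus or has a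
forest split.** -/
theorem eq_hexTubeOdd_or_hasForestSplit (hc : 15 ≤ c) (hL : L = 2 * c + 1)
    (hy : lay (0 : Fin 3) 1 y = ((c : ℕ) : ZMod L)) {Q : Finset (Plaquette 3 L)}
    (hQ : Q ⊆ restPlaqs (0 : Fin 3) 1 (c + 1)) (hQ6 : Q.card ≤ 6) :
    Q = hexTubeOdd y ∨ HasForestSplit (Et y LE₁odd) (Et y LE₂) Q :=
  eq_tube_or_hasForestSplit_of_checkR (B := 4) (V := restPlaqs (0 : Fin 3) 1 (c + 1)) (by omega)
    (fun p hp hpV => lrestOdd_of_mem_restPlaqs hL hy (B := 4 + 2) (by omega) hp hpV)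
    inBox_LE₁odd inBox_LE₂ checkR_hexCertOdd hQ hQ6

/-- The odd annulus consists of rest plaquettes. -/
theorem hexTubeOdd_subset_restPlaqs (hc : 15 ≤ c) (hL : L = 2 * c + 1)
    (hy : lay (0 : Fin 3) 1 y = ((c : ℕ) : ZMod L)) : hexTubeOdd y ⊆ restPlaqs (0 : Fin 3) 1 (c + 1) := by
  intro q hq
  obtain ⟨p, hp, rfl⟩ := mem_Pt.1 hq
  have h : (tubeTodd.all fun p => lrestOdd p) = true := by decide +kernel
  exact mem_restPlaqs_of_lrestOdd hL hy (B := 4) (by omega) (inBox_tubeTodd p hp)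
    ((List.all_eq_true.1 h) p hp)

omit [NeZero L] in
/-- The odd annulus has six faces (`L > 8`). -/
theorem card_hexTubeOdd (hL : 8 < L) : (hexTubeOdd y).card = 6 := by
  have hnd : tubeTodd.Nodup := by decide +kernel
  have h := card_Pt (y := y) (B := 4) (by omega) inBox_tubeTodd hnd
  unfold hexTubeOdd
  rw [h]
  rfl

omit [NeZero L] in
/-- The odd annulus joins the two hexagons. -/
theorem tjoins_hexTubeOdd : TJoins (hexTubeOdd y) (Et y LE₁odd) (Et y LE₂) := by
  -- bottom faces `b₂ = ((1,0,0),0)` (reads `((1,0,0),0) ∈ LE₁odd`), `b₁ = ((0,0,0),0)` (reads `((0,0,0),1) ∈ LE₂`)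
  have hb2 : plaq y ((1, 0, 0), 0) ∈ hexTubeOdd y := mem_Pt.2 ⟨_, by decide, rfl⟩
  have hb1 : plaq y ((0, 0, 0), 0) ∈ hexTubeOdd y := mem_Pt.2 ⟨_, by decide, rfl⟩
  refine ⟨plaq y ((1, 0, 0), 0), hb2, plaq y ((0, 0, 0), 0), hb1, ?_, ?_, ?_⟩
  · exact ⟨0, by rw [link_plaq]; exact mem_Et.2 ⟨_, by decide, rfl⟩⟩
  · exact ⟨3, by rw [link_plaq]; exact mem_Et.2 ⟨_, by decide, rfl⟩⟩
  · exact Polymer.Reach.single hb2 hb1 (padj_plaq_of_llink (y := y) (a := 3) (b := 1) (by decide))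

/-! ## The small-cluster sum collapses to the odd annulus -/

variable {N : ℕ} {G : Type*} [Group G] [TopologicalSpace G] [IsTopologicalGroup G] [CompactSpace G]
  [MeasurableSpace G] [BorelSpace G] [SecondCountableTopology G] (ρ : G →* Matrix (Fin N) (Fin N) ℂ)

open Classical in
/-- ★★ **On odd tori the small joining clusters contribute only through the short annulus.** -/
theorem sum_replicaTerm_small_eq_hexTubeOdd (hc : 15 ≤ c) (hL : L = 2 * c + 1)
    (hy : lay (0 : Fin 3) 1 y = ((c : ℕ) : ZMod L)) (hρ : Continuous ρ)
    {f g : GaugeConfig 3 L G → ℝ} (hfm : Measurable f) (hgm : Measurable g) {Cf Cg : ℝ}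
    (hfb : ∀ U, |f U| ≤ Cf) (hgb : ∀ U, |g U| ≤ Cg) (hfinv : IsGaugeInvariant f)
    (hfE : DependsOn f (Et y LE₁odd : Set (Edge 3 L))) (hgE : DependsOn g (Et y LE₂ : Set (Edge 3 L)))
    (z : ℂ) :
    ∑ Q ∈ (restPlaqs (0 : Fin 3) 1 (c + 1)).powerset.filter
        (fun Q => TJoins Q (Et y LE₁odd) (Et y LE₂) ∧ Q.card ≤ 6), replicaTerm ρ f g Q z =
      replicaTerm ρ f g (hexTubeOdd y) z := by
  have hL8 : 8 < L := by omega
  refine Finset.sum_eq_single_of_mem (hexTubeOdd y) ?_ fun Q hQ hne => ?_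
  · rw [mem_filter, mem_powerset]
    exact ⟨hexTubeOdd_subset_restPlaqs hc hL hy, tjoins_hexTubeOdd, (card_hexTubeOdd hL8).le⟩
  · rw [mem_filter, mem_powerset] at hQ
    rcases eq_hexTubeOdd_or_hasForestSplit hc hL hy hQ.1 hQ.2.2 with h | h
    · exact absurd h hne
    · obtain ⟨Q₁, Q₂, hQU, hdisj, hF⟩ := h.exists_gaugeFixable (G := G)
      exact replicaTerm_eq_zero_of_forestSplit ρ hρ hfm hgm hfb hgb hfinv hfE hgE hQU hdisj hF z

end DiagRPHex

end

end Summit.QuantumFields.GaugeBoot
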